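import Summits.CriticalPhenomena.PercolationContinuityZ3.Theorems.PercNearOneGluingNoHeavyLowerTailIncStarIrreducibleTools
import Summits.CriticalPhenomena.PercolationContinuityZ3.Theorems.PercNearOneGluingNoHeavyLowerTailSahiRootSideClaw
import Summits.CriticalPhenomena.PercolationContinuityZ3.Theorems.PercNearOneGluingNoHeavyLowerTailSahiSeriesReduction
import HarnessLib

/-!
# The increasing star reduces to irreducible marked graphs (one kernel theorem for the structure theory of gens 8–12)

Support file for the Sahi programme (`--supports stmt-CriticalPhenomena-4575`, prover prim-sahi-p2 gen 12).  No definitions, no named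
facts, no sorries; standard axioms.  Memo `…/prim-sahi-p2/PROOF-E3.md` §23.

**Theorem `incStar_of_irreducible`.**  Suppose the increasing-star inequality
`0 ≤ E₃({s↔a},{s↔b},{s↔c})` (Sahi's `E₃` of three root-connection events of Bernoulli bond percolation) holds for every
weight `w : Sym2 (Fin n) → [0,1]` and all marks `s, a, b, c : Fin n` that form an IRREDUCIBLE marked weighted graph, namely
* the four marks are pairwise distinct and `w` has no loops (`w s(x,x) = 0`);
* (2-connected) every cut-vertex decomposition `Fin n = V₁ ∪ V₂`, `V₁ ∩ V₂ = {x}`, `s ∈ V₁`, no pair of positive weight between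
  `V₁ ∖ {x}` and `V₂ ∖ {x}`, is trivial (`V₁ = {x}` or `V₂ = {x}`);
* (degree) every unmarked vertex has, for any two other vertices `y ≠ y'`, a neighbour of positive weight outside `{y, y'}`
  (no unmarked vertex of degree `≤ 2`);
* (no blob) every nonempty vertex set `B` avoiding the marks and two further vertices `u ≠ v` sends a pair of positive weight
  to the outside of `B ∪ {u,v}`;
* (no root side) every vertex set `R ∋ s` with a second vertex `h`, avoiding the targets and two further vertices `u ≠ v`,
  sends a pair of positive weight to the outside of `R ∪ {u,v}`.
Then the increasing star holds for EVERY weight on EVERY finite vertex type and all marks.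

**Proof** = strong induction on the number of vertices, one previously landed reduction per failed clause:
coincident marks (`IncStarIrreducible.incStar_of_not_distinct`), loops (the events ignore diagonal pairs), a cut vertex
(`IncStarCutVertex.incStar_of_cutVertex`, gen 8), an unmarked vertex of degree ≤ 2 (`SahiSeriesReduction.sahiE_principal_seriesReduce`,
gen 10), a blob (`SahiBlobReduction.exists_blobReduce`, gen 11), a targetless root side (`SahiRootSide.incStar_of_rootSide`, gen 12),
each time landing in a vertex set of smaller size where the induction hypothesis is imported by the transport lemma
`IncStarIrreducible.incStar_openConnIn_of_fin`.  What is NOT here: any claim that irreducible graphs satisfy the star (that is the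
open increasing-star conjecture; certified for `n ≤ 7` by the exact K₇ fibre array of memo §22h, and for `n ≤ 5` by the
`native_decide` comb certificates behind `FrontierIncRows.incStar_le_five`).
-/

noncomputable section

namespace Summit.CriticalPhenomena.PercolationContinuityZ3.Theorems

namespace IncStarIrreducible

open Finset MeasureTheory Literature.Combinatorics.Sahi2008 Literature.Probability.Percolation
  Literature.Probability.LatticeModels
open Literature.Probability.Percolation.DecisionTree (ind ind_of_mem ind_of_not_mem ind_nonneg)
open Literature.Probability.Percolation.BlockExploration (exists_openWalk_of_mem_openConnIn
  mem_openConn_iff_openConnIn_univ)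
open scoped Classical

variable {V : Type*}

/-- `{x ↔ t} = {x ↔ t in univ}` as sets (plumbing). [folklore] -/
theorem openConn_eq_openConnIn_univ (x t : V) :
    (openConn x t : Set (BondConfig V)) = openConnIn Set.univ x t := by
  ext ω; exact mem_openConn_iff_openConnIn_univ

variable [Fintype V]

/-- `E₃` of the increasing star ignores loops: it is unchanged when all diagonal pairs are switched off. [this work] -/
theorem sahiE3_openConn_congr_offDiag (w w' : Sym2 V → unitInterval)
    (h : ∀ e : Sym2 V, ¬ e.IsDiag → w e = w' e) (x t₁ t₂ t₃ : V) :
    sahiE3 (prodBernoulli w) (openConn x t₁) (openConn x t₂) (openConn x t₃) =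
      sahiE3 (prodBernoulli w') (openConn x t₁) (openConn x t₂) (openConn x t₃) := by
  simp only [openConn_eq_openConnIn_univ]
  exact sahiE3_openConnIn_congr_weight w w' Set.univ (fun e he _ => h e he) x t₁ t₂ t₃

/-- The increasing star as the order-3 Sahi functional of the singleton principal family, transported along an equality of
such functionals (plumbing for the series / blob reductions, which are stated for `sahiE`). [folklore] -/
theorem sahiE3_openConn_eq_of_sahiE_eq (w w' : Sym2 V → unitInterval) {s a b c : V}
    (h : ∀ (T : Fin 3 → Finset V), (∀ i, ∀ t ∈ T i, t = a ∨ t = b ∨ t = c) →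
      sahiE (bernoulliWeight w) 3 (fun i => ind (⋂ t ∈ T i, (openConn s t : Set (BondConfig V)))) =
        sahiE (bernoulliWeight w') 3 (fun i => ind (⋂ t ∈ T i, (openConn s t : Set (BondConfig V))))) :
    sahiE3 (prodBernoulli w) (openConn s a) (openConn s b) (openConn s c) =
      sahiE3 (prodBernoulli w') (openConn s a) (openConn s b) (openConn s c) := by
  rw [sahiE3_openConn_eq_sahiE_singletons, sahiE3_openConn_eq_sahiE_singletons]
  refine h _ fun i t ht => ?_
  fin_cases i
  · exact Or.inl (by simpa using ht)
  · exact Or.inr (Or.inl (by simpa using ht))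
  · exact Or.inr (Or.inr (by simpa using ht))

/-- **The increasing star holds everywhere as soon as it holds on every irreducible marked weighted graph.**  See the module
docstring for the irreducibility clauses (pairwise distinct marks, no loops, 2-connected, no unmarked vertex of degree ≤ 2, no blob,
no targetless root side) and for the reductions used. [this work] -/
theorem incStar_of_irreducible
    (H : ∀ (n : ℕ) (w : Sym2 (Fin n) → unitInterval) (s a b c : Fin n),
      s ≠ a → s ≠ b → s ≠ c → a ≠ b → a ≠ c → b ≠ c →
      (∀ x : Fin n, w s(x, x) = 0) →
      (∀ (V₁ V₂ : Finset (Fin n)) (x : Fin n), (∀ y, y ∈ V₁ → y ∈ V₂ → y = x) → x ∈ V₁ → x ∈ V₂ → s ∈ V₁ →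
          (∀ y, y ∈ V₁ ∨ y ∈ V₂) → (∀ y z, y ∈ V₁ → z ∈ V₂ → y ≠ x → z ≠ x → w s(y, z) = 0) →
          (∀ y ∈ V₁, y = x) ∨ (∀ z ∈ V₂, z = x)) →
      (∀ x y y' : Fin n, x ≠ s → x ≠ a → x ≠ b → x ≠ c → x ≠ y → x ≠ y' → y ≠ y' →
          ∃ z, z ≠ y ∧ z ≠ y' ∧ w s(x, z) ≠ 0) →
      (∀ (B : Finset (Fin n)) (u v : Fin n), B.Nonempty → u ∉ B → v ∉ B → u ≠ v → s ∉ B → a ∉ B → b ∉ B → c ∉ B →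
          ∃ x ∈ B, ∃ z, z ∉ B ∧ z ≠ u ∧ z ≠ v ∧ w s(x, z) ≠ 0) →
      (∀ (R : Finset (Fin n)) (h u v : Fin n), s ∈ R → h ∈ R → h ≠ s → u ∉ R → v ∉ R → u ≠ v → a ∉ R → b ∉ R →
          c ∉ R → ∃ x ∈ R, ∃ z, z ∉ R ∧ z ≠ u ∧ z ≠ v ∧ w s(x, z) ≠ 0) →
      0 ≤ sahiE3 (prodBernoulli w) (openConn s a) (openConn s b) (openConn s c))
    (w : Sym2 V → unitInterval) (s a b c : V) :
    0 ≤ sahiE3 (prodBernoulli w) (openConn s a) (openConn s b) (openConn s c) := by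
  -- the statement on `Fin n`, by strong induction on `n`
  have finv : ∀ (n : ℕ) (w : Sym2 (Fin n) → unitInterval) (s a b c : Fin n),
      0 ≤ sahiE3 (prodBernoulli w) (openConn s a) (openConn s b) (openConn s c) := by
    intro n
    induction n using Nat.strong_induction_on with
    | _ n ih =>
    intro w₁ s a b c
    -- (0) coincident marks
    by_cases hdist : s ≠ a ∧ s ≠ b ∧ s ≠ c ∧ a ≠ b ∧ a ≠ c ∧ b ≠ c
    swap
    · push Not at hdist
      refine incStar_of_not_distinct w₁ ?_
      tauto
    obtain ⟨hsa, hsb, hsc, hab, hac, hbc⟩ := hdist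
    -- loops off
    obtain ⟨w, hwdef⟩ : ∃ w : Sym2 (Fin n) → unitInterval, ∀ e, w e = if e.IsDiag then 0 else w₁ e := ⟨_, fun e => rfl⟩
    rw [sahiE3_openConn_congr_offDiag w₁ w (fun e he => by rw [hwdef, if_neg he]) s a b c]
    have hloop : ∀ x : Fin n, w s(x, x) = 0 := fun x => by rw [hwdef, if_pos (Sym2.mk_isDiag_iff.2 rfl)]
    have hcardn : Fintype.card (Fin n) = n := Fintype.card_fin n
    -- the induction hypothesis, transported into any proper vertex set
    have IH : ∀ (w' : Sym2 (Fin n) → unitInterval) (S : Finset (Fin n)), S.card < n → ∀ {x t₁ t₂ t₃ : Fin n},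
        x ∈ S → t₁ ∈ S → t₂ ∈ S → t₃ ∈ S →
        0 ≤ sahiE3 (prodBernoulli w') (openConnIn (↑S : Set (Fin n)) x t₁) (openConnIn (↑S : Set (Fin n)) x t₂)
          (openConnIn (↑S : Set (Fin n)) x t₃) :=
      fun w' S hS x t₁ t₂ t₃ hx h₁ h₂ h₃ => incStar_openConnIn_of_fin (ih S.card hS) w' S rfl hx h₁ h₂ h₃
    -- (1) a cut vertex
    by_cases hI1 : ∀ (V₁ V₂ : Finset (Fin n)) (x : Fin n), (∀ y, y ∈ V₁ → y ∈ V₂ → y = x) → x ∈ V₁ → x ∈ V₂ → s ∈ V₁ →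
        (∀ y, y ∈ V₁ ∨ y ∈ V₂) → (∀ y z, y ∈ V₁ → z ∈ V₂ → y ≠ x → z ≠ x → w s(y, z) = 0) →
        (∀ y ∈ V₁, y = x) ∨ (∀ z ∈ V₂, z = x)
    swap
    · push Not at hI1
      obtain ⟨V₁, V₂, x, hV, hx₁, hx₂, hs₁, hunion, hsep, ⟨y₀, hy₀, hy₀x⟩, ⟨z₀, hz₀, hz₀x⟩⟩ := hI1
      have hz₀V₁ : z₀ ∉ V₁ := fun h => hz₀x (hV z₀ h hz₀)
      have hy₀V₂ : y₀ ∉ V₂ := fun h => hy₀x (hV y₀ hy₀ h)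
      have hlt₁ : V₁.card < n := by simpa [hcardn] using Finset.card_lt_univ_of_notMem hz₀V₁
      have hlt₂ : V₂.card < n := by simpa [hcardn] using Finset.card_lt_univ_of_notMem hy₀V₂
      refine IncStarCutVertex.incStar_of_cutVertex w (V₁ := (↑V₁ : Set (Fin n))) (V₂ := (↑V₂ : Set (Fin n)))
        (a := x) (s := s) (fun y hy hy' => hV y hy hy') hx₁ hx₂ hs₁ (fun y => ?_) (fun y z hy hz hyx hzx => hsep y z hy hz hyx hzx)
        (fun p q r hp hq hr => IH w V₁ hlt₁ hs₁ hp hq hr) (fun p q r hp hq hr => IH w V₂ hlt₂ hx₂ hp hq hr) a b c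
      rcases hunion y with h | h
      · exact Or.inl h
      · exact Or.inr h
    -- (2) an unmarked vertex of degree ≤ 2 (series / pendant / isolated)
    by_cases hI2 : ∀ x y y' : Fin n, x ≠ s → x ≠ a → x ≠ b → x ≠ c → x ≠ y → x ≠ y' → y ≠ y' →
        ∃ z, z ≠ y ∧ z ≠ y' ∧ w s(x, z) ≠ 0
    swap
    · push Not at hI2
      obtain ⟨x, y, y', hxs, hxa, hxb, hxc, hxy, hxy', hyy', hdeg⟩ := hI2
      -- the reduced weight
      have hval : (1 : ℝ) - (1 - w s(y, y')) * (1 - w s(x, y) * w s(x, y')) ∈ unitInterval := by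
        have p0 := (w s(y, y')).2.1; have p1 := (w s(y, y')).2.2
        have q0 := (w s(x, y)).2.1; have q1 := (w s(x, y)).2.2
        have r0 := (w s(x, y')).2.1; have r1 := (w s(x, y')).2.2
        constructor <;> nlinarith [mul_nonneg q0 r0, mul_le_one₀ q1 r0 r1]
      obtain ⟨w', hw'def⟩ : ∃ w' : Sym2 (Fin n) → unitInterval, ∀ e, w' e =
          if x ∈ e then 0 else if e = s(y, y') then ⟨_, hval⟩ else w e := ⟨_, fun e => rfl⟩
      have hw'x : ∀ z, w' s(x, z) = 0 := fun z => by rw [hw'def, if_pos (Sym2.mem_mk_left x z)]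
      have hw'e : ∀ e, x ∉ e → e ≠ s(y, y') → w' e = w e := fun e he hne => by rw [hw'def, if_neg he, if_neg hne]
      have hw'yy : (w' s(y, y') : ℝ) = 1 - (1 - w s(y, y')) * (1 - w s(x, y) * w s(x, y')) := by
        have hx : x ∉ s(y, y') := by
          intro h; rcases Sym2.mem_iff.1 h with h | h; exacts [hxy h, hxy' h]
        rw [hw'def, if_neg hx, if_pos rfl]
      have hred := SahiSeriesReduction.sahiE_principal_seriesReduce w w' hxy hxy' hyy' (Ne.symm hxs)
        (fun z hz hz' => hdeg z hz hz') hw'x hw'e hw'yy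
      rw [sahiE3_openConn_eq_of_sahiE_eq w w' (fun T hT => hred 3 T fun i hxT => ?_)]
      swap
      · rcases hT i x hxT with h | h | h; exacts [hxa h, hxb h, hxc h]
      -- under `w'` the vertex `x` is isolated: compute inside `univ.erase x`
      set S : Finset (Fin n) := Finset.univ.erase x with hSdef
      have hSexit : ∀ p ∈ (↑S : Set (Fin n)), ∀ q ∉ (↑S : Set (Fin n)), w' s(p, q) = 0 := by
        intro p _ q hq
        have hqx : q = x := by
          by_contra h; exact hq (Finset.mem_coe.2 (Finset.mem_erase.2 ⟨h, Finset.mem_univ q⟩))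
        rw [hqx, Sym2.eq_swap]; exact hw'x p
      have memS : ∀ {p : Fin n}, p ≠ x → p ∈ S := fun hp => Finset.mem_erase.2 ⟨hp, Finset.mem_univ _⟩
      rw [sahiE3_openConn_eq_openConnIn_of_no_exit w' (↑S) hSexit (Finset.mem_coe.2 (memS (Ne.symm hxs)))]
      have hScard : S.card < n := by
        rw [hSdef, Finset.card_erase_of_mem (Finset.mem_univ x), Finset.card_univ, hcardn]; omega
      exact IH w' S hScard (memS (Ne.symm hxs)) (memS (Ne.symm hxa)) (memS (Ne.symm hxb)) (memS (Ne.symm hxc))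
    -- (3) a blob
    by_cases hI3 : ∀ (B : Finset (Fin n)) (u v : Fin n), B.Nonempty → u ∉ B → v ∉ B → u ≠ v → s ∉ B → a ∉ B → b ∉ B →
        c ∉ B → ∃ x ∈ B, ∃ z, z ∉ B ∧ z ≠ u ∧ z ≠ v ∧ w s(x, z) ≠ 0
    swap
    · push Not at hI3
      obtain ⟨B, u, v, hBne, hu, hv, huv, hsB, haB, hbB, hcB, hblob⟩ := hI3
      obtain ⟨w', hw'B, -, -, hE⟩ := SahiBlobReduction.exists_blobReduce w B hu hv huv
        (fun x hx z hz hzu hzv => hblob x hx z hz hzu hzv)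
      rw [sahiE3_openConn_eq_of_sahiE_eq w w' (fun T hT => hE s hsB 3 T fun i t ht => ?_)]
      swap
      · rcases hT i t ht with rfl | rfl | rfl; exacts [haB, hbB, hcB]
      set S : Finset (Fin n) := Finset.univ \ B with hSdef
      have memS : ∀ {p : Fin n}, p ∉ B → p ∈ S := fun hp => Finset.mem_sdiff.2 ⟨Finset.mem_univ _, hp⟩
      have hSexit : ∀ p ∈ (↑S : Set (Fin n)), ∀ q ∉ (↑S : Set (Fin n)), w' s(p, q) = 0 := by
        intro p _ q hq
        have hqB : q ∈ B := by
          by_contra h; exact hq (Finset.mem_coe.2 (memS h))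
        rw [Sym2.eq_swap]; exact hw'B q hqB p
      rw [sahiE3_openConn_eq_openConnIn_of_no_exit w' (↑S) hSexit (Finset.mem_coe.2 (memS hsB))]
      have hScard : S.card < n := by
        obtain ⟨x₀, hx₀⟩ := hBne
        have : x₀ ∉ S := fun h => (Finset.mem_sdiff.1 h).2 hx₀
        simpa [hcardn] using Finset.card_lt_univ_of_notMem this
      exact IH w' S hScard (memS hsB) (memS haB) (memS hbB) (memS hcB)
    -- (4) a targetless root side
    by_cases hI4 : ∀ (R : Finset (Fin n)) (h u v : Fin n), s ∈ R → h ∈ R → h ≠ s → u ∉ R → v ∉ R → u ≠ v → a ∉ R →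
        b ∉ R → c ∉ R → ∃ x ∈ R, ∃ z, z ∉ R ∧ z ≠ u ∧ z ≠ v ∧ w s(x, z) ≠ 0
    swap
    · push Not at hI4
      obtain ⟨R, h, u, v, hsR, hhR, hhs, huR, hvR, huv, haR, hbR, hcR, hside⟩ := hI4
      refine SahiRootSide.incStar_of_rootSide w R hsR hhR (Ne.symm hhs) huR hvR huv
        (fun x hx z hz hzu hzv => hside x hx z hz hzu hzv) (fun w' _ _ x y z hx hy hz => ?_) haR hbR hcR
      set S : Finset (Fin n) := Finset.univ.erase s with hSdef
      have hS : (↑S : Set (Fin n)) = {t : Fin n | t ≠ s} := by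
        ext t; simp [hSdef]
      have memS : ∀ {p : Fin n}, p ≠ s → p ∈ S := fun hp => Finset.mem_erase.2 ⟨hp, Finset.mem_univ _⟩
      have hScard : S.card < n := by
        rw [hSdef, Finset.card_erase_of_mem (Finset.mem_univ s), Finset.card_univ, hcardn]; omega
      have key := IH w' S hScard (memS hhs) (memS hx) (memS hy) (memS hz)
      rwa [hS] at key
    -- (5) irreducible: the hypothesis
    exact H n w s a b c hsa hsb hsc hab hac hbc hloop hI1 hI2 hI3 hI4
  -- transport to an arbitrary finite vertex type
  have key := incStar_openConnIn_of_fin (V := V) (m := Fintype.card V) (fun w₀ s a b c => finv _ w₀ s a b c) w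
    Finset.univ Finset.card_univ (Finset.mem_univ s) (Finset.mem_univ a) (Finset.mem_univ b) (Finset.mem_univ c)
  rw [Finset.coe_univ] at key
  simpa only [openConn_eq_openConnIn_univ] using key

end IncStarIrreducible

end Summit.CriticalPhenomena.PercolationContinuityZ3.Theorems
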